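import Summits.CriticalPhenomena.PercolationContinuityZ3.Theses.PercLowPointHalfSpace
import Literature.Probability.Percolation.CriticalContinuity
import Literature.Probability.Percolation.HalfSpace
import Literature.Probability.Percolation.UniversalTightness
import Literature.Probability.Percolation.HalfSpaceFloorDilution
import Literature.Probability.Percolation.MeanFieldBetaFromGamma
import Literature.Probability.Percolation.SusceptibilityGammaOne

/-!
# Sketch — crux-ideate round 2, ideator 4, crux stmt-CriticalPhenomena-0912 (`TallClusterMassBound`, B)

Typed statements (no proofs claimed; every `def … : Prop`) for the dictionary facts recorded in
`Findings-ideator4.md`.  All constants `lean search`ed: `bondPercolation`, `zdGraph`, `criticalProbI`,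
`openConnIn`, `box`, `theta`, `PercolationContinuityZ3`, `Site`.

* §1 the WIRED-WALL PROFILE `q(h) = P_{p_c}((h,0,0) ↔_ℍ ∂ℍ)` and the sandwich
  `θ(p_c) ≤ q(h) ≤ P_{p_c}(0 ↔ ∂B_h)`, hence `q(h) ↓ θ(p_c)`: the conjunct is `q(h) → 0` and any RATE
  for `q` closes the summit (costume test for profile-type residuals).
* §2 the box-exit identity for the wall arm and the independent-boxes steering bound.
-/

noncomputable section

open MeasureTheory Filter
open Literature.Probability.Percolation Literature.Probability.LatticeModels

namespace Summit.CriticalPhenomena.PercolationContinuityZ3.Cruxes.TallClusterMassBound.Ideas4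

/-- Vertices of `ℤ³`. -/
abbrev V3 : Type := Site 3

/-- The half-space `ℍ = {x | 0 ≤ x₀}`, verbatim as in the route file. -/
def Hs : Set V3 := {x | 0 ≤ x 0}

/-- The wall `∂ℍ = {x | x₀ = 0}`. -/
def wall : Set V3 := {x | x 0 = 0}

/-- `P_{p_c(ℤ³)}`. -/
def Pc : Measure (BondConfig V3) := bondPercolation (zdGraph 3) (criticalProbI 3)

/-- The point `(h,0,0)` at height `h` on the normal axis. -/
def up (h : ℕ) : V3 := Pi.single 0 (h : ℤ)

/-- The WIRED-WALL PROFILE (one-point function of the half-space with absorbing wall):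
`q(h) = P_{p_c}((h,0,0) is joined to SOME wall vertex by an open path inside ℍ)`. -/
def profile (h : ℕ) : ℝ := Pc.real {ω | ∃ u : V3, u ∈ wall ∧ ω ∈ openConnIn Hs (up h) u}

/-- The bulk one-arm probability `P_{p_c}(0 ↔ ∂B(n))` (tree event `siteToBoundary`). -/
def bulkArm (n : ℕ) : ℝ := Pc.real (siteToBoundary 3 n)

/-- §1(a) LOWER SANDWICH (provable now from `BarskyGrimmettNewman1991_Z3_holds` + finite energy +
first-exit decomposition): an infinite open path from `(h,0,0)` either stays in `ℍ` (a null event: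
`θ_ℍ(p_c) = 0` at every vertex of `ℍ`) or leaves `ℍ`, and just before it first leaves it sits on the
wall; by translation invariance `θ(p_c) = P(up h ↔ ∞)`.  Hence `θ(p_c) ≤ q(h)` for EVERY `h`. -/
def ProfileGeTheta : Prop :=
  ∀ h : ℕ, theta (zdGraph 3) (0 : V3) (criticalProbI 3) ≤ profile h

/-- §1(b) UPPER SANDWICH (provable now, translation + monotonicity in the domain): reaching the wall
from height `h` forces an arm of sup-length `h`, so `q(h) ≤ P_{p_c}(0 ↔ ∂B(h))` (which `→ θ(p_c)`). -/
def ProfileLeBulkArm : Prop :=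
  ∀ h : ℕ, 1 ≤ h → profile h ≤ bulkArm h

/-- §1(c) MONOTONICITY FOR FREE (nested half-spaces: `{x₀ ≥ 1} ⊂ {x₀ ≥ 0}` and the shift by `e₀`):
`q(h+1) ≤ q(h)`. -/
def ProfileAntitone : Prop :=
  ∀ h : ℕ, profile (h + 1) ≤ profile h

/-- §1(d) THE CONJUNCT IN PROFILE FORM: `q(h) → θ(p_c)`; so `PercolationContinuityZ3 ↔ q(h) → 0`. -/
def ProfileTendstoTheta : Prop :=
  Tendsto profile atTop (nhds (theta (zdGraph 3) (0 : V3) (criticalProbI 3)))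

/-- A RATE for the profile (any `a > 0`).  Heuristically `q(h) ≍ h^{-x_h}`, `x_h = 3 - d_f ≈ 0.477`,
and crux B ⟺ `a ≥ 1/4` is attainable (Findings §1).  -/
def ProfileRate (a : ℝ) : Prop :=
  ∃ C : ℝ, ∀ h : ℕ, 1 ≤ h → profile h ≤ C * (h : ℝ) ^ (-a)

/-- §1(e) COSTUME TEST, typed: given §1(a), ANY profile rate closes the summit in three lines
(`θ ≤ q(h) ≤ C h^{-a} → 0`).  So a crux line whose residual is a profile-rate statement relocates B
into the conjunct-with-a-rate (triage rule (iv)); recorded so that round-3 ideators do not file it. -/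
def ProfileRateClosesSummit : Prop :=
  ProfileGeTheta → ∀ a : ℝ, 0 < a → ProfileRate a → _root_.PercolationContinuityZ3

/-- §2(a) BOX-EXIT IDENTITY for the crux's wall arm (provable now: the first exit of `B(ℓ-1)` by a
path realising `arm_ℍ(0,ℓ)` happens inside `B(ℓ)`): the arm event of the route decl equals the LOCAL
event "`0` is joined inside `ℍ ∩ B(ℓ)` to a vertex of sup-norm `≥ ℓ`".  Consequence: arm events of
seeds at mutual sup-distance `> 2ℓ` are independent (§2(b)). -/
def ArmEventLocal : Prop :=
  ∀ ℓ : ℕ, {ω : BondConfig V3 | ∃ y : V3, (∃ i : Fin 3, (ℓ : ℤ) ≤ |y i|) ∧ ω ∈ openConnIn Hs 0 y}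
    = {ω | ∃ y : V3, (∃ i : Fin 3, (ℓ : ℤ) ≤ |y i|) ∧ ω ∈ openConnIn (Hs ∩ ↑(box 3 ℓ)) 0 y}

/-- The wall-arm probability `π_s(ℓ)` of the route decl. -/
def armProb (ℓ : ℕ) : ℝ :=
  Pc.real {ω | ∃ y : V3, (∃ i : Fin 3, (ℓ : ℤ) ≤ |y i|) ∧ ω ∈ openConnIn Hs 0 y}

/-- §2(b) QUANTITATIVE SAME-`p` STEERING FROM SEPARATED SEEDS (provable now from §2(a) +
independence of disjoint coordinate sets of the product measure + translation invariance along the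
wall): if `Z` is a finite set of WALL vertices pairwise at sup-distance `> 2ℓ`, the probability that
NO seed of `Z` has an `ℓ`-arm in `ℍ` is at most `(1 - π_s(ℓ))^{|Z|}`.  (The fresh-half-space version
above a stopping level follows by the cluster Markov property, as in card accessible-skeleton (B).)
This is the only "many independent trials" resource of the nearest-neighbour half-space — the
analogue of Hutchcroft's fresh long edges — and Findings §3 records why it bounds heights/extents of
tall clusters but never their MASS. -/
def SeparatedSeedsSteer : Prop :=
  ∀ (ℓ : ℕ) (Z : Finset V3), (∀ z ∈ Z, z ∈ wall) →
    (∀ z ∈ Z, ∀ z' ∈ Z, z ≠ z' → ∃ i : Fin 3, (2 * (ℓ : ℤ) + 1) ≤ |z i - z' i|) →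
    Pc.real {ω | ∀ z ∈ Z, ¬ ∃ y : V3, (∃ i : Fin 3, (ℓ : ℤ) ≤ |y i - z i|) ∧ ω ∈ openConnIn Hs z y}
      ≤ (1 - armProb ℓ) ^ Z.card

/-- §1(e) is kernel-checkable today: the costume implication itself is five lines of logic
(compare the triagers' `Costume.lean` / `Relocation.lean` for quarter-arm and gladkov-schur). -/
theorem profileRateClosesSummit_holds : ProfileRateClosesSummit := by
  intro hge a ha hrate
  obtain ⟨C, hC⟩ := hrate
  show theta (zdGraph 3) (0 : V3) (criticalProbI 3) = 0
  have hθ0 : 0 ≤ theta (zdGraph 3) (0 : V3) (criticalProbI 3) := by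
    unfold theta; exact measureReal_nonneg
  have hlim : Tendsto (fun h : ℕ => C * (h : ℝ) ^ (-a)) atTop (nhds 0) := by
    have h1 : Tendsto (fun h : ℕ => (h : ℝ) ^ (-a)) atTop (nhds 0) :=
      (tendsto_rpow_neg_atTop ha).comp tendsto_natCast_atTop_atTop
    simpa using h1.const_mul C
  have hle : theta (zdGraph 3) (0 : V3) (criticalProbI 3) ≤ 0 :=
    ge_of_tendsto hlim (eventually_atTop.2 ⟨1, fun h hh => (hge h).trans (hC h hh)⟩)
  exact le_antisymm hle hθ0

/-! ## §3 Card `universal-tightness-volume-tail`: B ⟸ typical max half-box volume ⟸ bulk volume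
tail (δ < 11) ⟸ subcritical susceptibility (γ < 20/11).  All objects below exist in the tree:
`typicalMax` / `clusterCapIn` (UniversalTightness.lean, Hutchcroft 2021 Thm 2.2, PROVED for every
product Bernoulli measure), `floorDilutedPercolation 3 p 1` (= bond percolation on the induced
half-space, a `prodBernoulli`), `clusterSizeGe` (MeanFieldBetaFromGamma.lean), `chi`
(SusceptibilityGammaOne.lean), `Hutchcroft2022_thm13_holds` (HutchcroftVolumeTail.lean, PROVED). -/

/-- Percolation on the induced half-space `ℍ` at `p_c(ℤ³)` as a PRODUCT measure on all bonds of `ℤ³`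
(weights `p_c` on `ℍ`-edges, `0` elsewhere): the instance of `prodBernoulli` to which the tree's
universal tightness applies; it agrees with `Pc` on every `openConnIn S` event, `S ⊆ ℍ`
(`floorDilutedPercolation_one_openConnIn`). -/
def PcH : Measure (BondConfig V3) := floorDilutedPercolation 3 (criticalProbI 3) 1

/-- The half-box `Λ_r = B_r ∩ ℍ`. -/
def halfBox (r : ℕ) : Finset V3 := (box 3 r).filter fun x => 0 ≤ x 0

/-- RESIDUAL STUB (wall-native, world-separating, NOT known to imply the conjunct):
the TYPICAL LARGEST VOLUME of a half-space cluster inside the half-box is `≤ C r^s`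
(`typicalMax μ Λ = min{n : P(|K_max(Λ)| ≥ n) ≤ e⁻¹}`, Hutchcroft 2021 §2.1).  Heuristic truth
`s = d_f ≈ 2.523`; B needs any `s < 11/4`. -/
def HalfBoxTypicalMax (s : ℝ) : Prop :=
  ∃ C : ℝ, ∀ r : ℕ, 1 ≤ r → (typicalMax PcH (halfBox r) : ℝ) ≤ C * (r : ℝ) ^ s

/-- Bulk critical volume tail `P_{p_c}(|C(0)| ≥ n) ≤ C n^{-θ}` ("`1/δ ≥ θ`"; truth `1/δ ≈ 0.189`;
B needs any `θ > 1/11`). -/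
def VolumeTailAt (θ : ℝ) : Prop :=
  ∃ C : ℝ, ∀ n : ℕ, 1 ≤ n → Pc.real (clusterSizeGe (0 : V3) n) ≤ C * (n : ℝ) ^ (-θ)

/-- Subcritical susceptibility exponent bound `χ(p) ≤ C (p_c - p)^{-γ}` on `ℤ³` ("`γ⁺ ≤ γ`"; truth
`γ ≈ 1.793`; B needs any `γ < 20/11 ≈ 1.818`; a jump world has `γ ≥ 2`, Newman 1986). -/
def SubcritGamma (γ : ℝ) : Prop :=
  ∃ C : ℝ, ∀ p : unitInterval, (p : ℝ) < criticalProb (zdGraph 3) (0 : V3) →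
    chi 3 p ≤ C * (criticalProb (zdGraph 3) (0 : V3) - (p : ℝ)) ^ (-γ)

/-- ARROW 1 (THE LEVER; provable now): rooted universal tightness
`P(|K_0 ∩ Λ| ≥ αM) ≤ e^{(3-α)/2} P(|K_0 ∩ Λ| ≥ M)` (tree `prodBernoulli_real_clusterCapIn_ge_le_exp_mul`)
+ layer cake + `π_s(r) ≥ c r^{-2}` (tree) give `E[|U ∩ B_r| ; arm] ≤ 2 M π_s(r) (5/2 + log(1/π_s(r)))
≤ C r^s log r · π_s(r)`, so any `s < 11/4` yields B. -/
def TightnessTransfer : Prop :=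
  ∀ s : ℝ, s < (11 : ℝ) / 4 → HalfBoxTypicalMax s →
    Summit.CriticalPhenomena.PercolationContinuityZ3.Theses.PercLowPointHalfSpace.TallClusterMassBound

/-- ARROW 2 (provable now): first moment for the maximum, `P(|K_max(Λ_r)| ≥ n) ≤ |Λ_r| · P_{p_c}(|C(0)| ≥ n)/n`
(on the event at least `n` vertices of `Λ_r` have `|K_v ∩ Λ_r| ≥ n`; `K^ℍ_v ⊆ C(v)`; translation
invariance of the bulk), hence `typicalMax ≤ C r^{3/(1+θ)}`. -/
def FirstMomentTransfer : Prop :=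
  ∀ θ : ℝ, 0 < θ → θ ≤ 1 → VolumeTailAt θ → HalfBoxTypicalMax (3 / (1 + θ))

/-- ARROW 3 (provable now from `Hutchcroft2022_thm13_holds` + Markov + `ε = n^{-1/2}`):
`P_{p_c}(|C| ≥ n) ≤ 2χ(p_c-ε)/n + C ε² χ(p_c-ε) ≤ C' n^{-(1-γ/2)}`. -/
def KLVolumeTail : Prop :=
  ∀ γ : ℝ, 1 ≤ γ → γ < 2 → SubcritGamma γ → VolumeTailAt (1 - γ / 2)

/-- THE LINE'S CLAIM: B is a corollary of a Newman-type subcritical bound at level `20/11`. -/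
def TallClusterMassBound_of_subcritGamma : Prop :=
  ∀ γ : ℝ, 1 ≤ γ → γ < (20 : ℝ) / 11 → SubcritGamma γ →
    Summit.CriticalPhenomena.PercolationContinuityZ3.Theses.PercLowPointHalfSpace.TallClusterMassBound

/-- Kernel-checked composition of the three arrows (exponent bookkeeping only:
`θ = 1 - γ/2 > 1/11` and `3/(1+θ) = 6/(4-γ) < 11/4` iff `γ < 20/11`). -/
theorem tallClusterMassBound_of_subcritGamma_of_arrows
    (h1 : TightnessTransfer) (h2 : FirstMomentTransfer) (h3 : KLVolumeTail) :
    TallClusterMassBound_of_subcritGamma := by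
  intro γ hγ1 hγ2 hS
  have hγlt2 : γ < 2 := by linarith
  have hθpos : 0 < 1 - γ / 2 := by linarith
  have hθle : 1 - γ / 2 ≤ 1 := by linarith
  have hV : VolumeTailAt (1 - γ / 2) := h3 γ hγ1 hγlt2 hS
  have hM : HalfBoxTypicalMax (3 / (1 + (1 - γ / 2))) := h2 _ hθpos hθle hV
  refine h1 _ ?_ hM
  have hden : 0 < 1 + (1 - γ / 2) := by linarith
  rw [div_lt_div_iff₀ hden (by norm_num : (0 : ℝ) < 4)]
  nlinarith

/-- B also from the volume tail alone (δ < 11): -/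
theorem tallClusterMassBound_of_volumeTail_of_arrows
    (h1 : TightnessTransfer) (h2 : FirstMomentTransfer) {θ : ℝ} (hθ : (1 : ℝ) / 11 < θ) (hθ1 : θ ≤ 1)
    (hV : VolumeTailAt θ) :
    Summit.CriticalPhenomena.PercolationContinuityZ3.Theses.PercLowPointHalfSpace.TallClusterMassBound := by
  have hθpos : 0 < θ := by linarith
  refine h1 _ ?_ (h2 θ hθpos hθ1 hV)
  have hden : 0 < 1 + θ := by linarith
  rw [div_lt_div_iff₀ hden (by norm_num : (0 : ℝ) < 4)]
  nlinarith

/-! ### §3b The SURFACE-CROSSOVER engine option (no summit-closing input).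
`χ_h(p)` = mean size of the half-space cluster of the point at height `h` (partial sums, uniform in `R`, to avoid
`tsum` junk).  Surface scaling: `χ_h(p) ≍ (p_c-p)^{-γ₁} min(1+h, ξ)^{κ}`, `κ = (γ-γ₁)/ν ≈ 0.50`, `γ₁ ≈ 1.36`. -/

/-- `SurfaceCrossover γ₁ κ`: `Σ_{x ∈ B_R} P_p((h,0,0) ↔_ℍ x) ≤ C (p_c - p)^{-γ₁} (1+h)^κ` for all `p < p_c`, `h`, `R`.
At `h = 0` this is crux C's open stub family (surface susceptibility exponent `γ₁`); `κ` is the depth-growth exponent.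
NOT known to imply the conjunct (the Newman-type jump-world argument refutes it only when `γ₁ + 2κ < 2`). -/
def SurfaceCrossover (γ₁ κ : ℝ) : Prop :=
  ∃ C : ℝ, ∀ p : unitInterval, (p : ℝ) < criticalProb (zdGraph 3) (0 : V3) → ∀ h R : ℕ,
    ∑ x ∈ box 3 R, (bondPercolation (zdGraph 3) p).real (openConnIn Hs (up h) x)
      ≤ C * (criticalProb (zdGraph 3) (0 : V3) - (p : ℝ)) ^ (-γ₁) * ((h : ℝ) + 1) ^ κ

/-- ARROW 2′ (provable now: the tree's general-degree KL lemma `real_clusterSizeGe_le_of_kl` on the induced half-space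
graph rooted at `(h,0,0)` + Markov at `ε = n^{-1/2}` gives `P_{p_c}(|K^ℍ_{(h,0,0)}| ≥ n) ≤ C n^{-(1-γ₁/2)} (1+h)^κ`; first
moment over `Λ_r` with `Σ_{h ≤ r} (2r+1)² (1+h)^κ ≤ C r^{3+κ}`): typical max `≤ C r^{(3+κ)/(2-γ₁/2)}`. -/
def CrossoverTransfer : Prop :=
  ∀ γ₁ κ : ℝ, 1 ≤ γ₁ → γ₁ < 2 → 0 ≤ κ → SurfaceCrossover γ₁ κ → HalfBoxTypicalMax ((3 + κ) / (2 - γ₁ / 2))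

/-- B from surface-crossover exponents alone: `5.5 γ₁ + 4 κ < 10` (truth `7.46 + 1.99 = 9.45`). -/
def TallClusterMassBound_of_surfaceCrossover : Prop :=
  ∀ γ₁ κ : ℝ, 1 ≤ γ₁ → 0 ≤ κ → 11 * γ₁ + 8 * κ < 20 → SurfaceCrossover γ₁ κ →
    Summit.CriticalPhenomena.PercolationContinuityZ3.Theses.PercLowPointHalfSpace.TallClusterMassBound

/-- Kernel-checked composition: `(3+κ)/(2-γ₁/2) < 11/4 ⟺ 11γ₁ + 8κ < 20` (and `γ₁ < 2` follows from the hypotheses). -/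
theorem tallClusterMassBound_of_surfaceCrossover_of_arrows
    (h1 : TightnessTransfer) (h2 : CrossoverTransfer) : TallClusterMassBound_of_surfaceCrossover := by
  intro γ₁ κ hγ hκ hlin hS
  have hγ2 : γ₁ < 2 := by nlinarith
  refine h1 _ ?_ (h2 γ₁ κ hγ hγ2 hκ hS)
  have hden : 0 < 2 - γ₁ / 2 := by linarith
  rw [div_lt_div_iff₀ hden (by norm_num : (0 : ℝ) < 4)]
  nlinarith

end Summit.CriticalPhenomena.PercolationContinuityZ3.Cruxes.TallClusterMassBound.Ideas4
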